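import Summits.NavierStokesRegularity.NavierStokesRegularity.Theorems.EfficiencyFloorNearSaturationNearMaximiserSeqCoreWeakPairing
import HarnessLib

/-!
# Route `EfficiencyFloor`, crux `NearSaturationNearMaximiser` (stmt-NavierStokesRegularity-25482) on the
# `ProductionEfficiencyDecay` ladder (stmt-22866): census items (b) and (c')-lin FROM WEAK CONVERGENCE AGAINST TEST FIELDS

Def-free helper file, sixth of the group `…SeqCoreUpgrade` / `…SeqCoreCentring` / `…SeqCorePythagoras` / `…SeqCoreSplitting` /
`…SeqCoreWeakPairing`. The remaining hypothesis (P_w') of `nearSaturationNearMaximiser_of_centredLocalWeakLimitMixed`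
(`…SeqCoreSplitting`) contains, along a subsequence `v_{φ k}` and for an admissible `w`, the clauses
(b) `∫⟪curl v_{φk}, curl w⟫ → Z(w)`, `∫Σᵢ⟪D curl v_{φk} eᵢ, D curl w eᵢ⟫ → Pal(w)` and (c'-lin) «the three mixed trilinear
stretching terms LINEAR in `r_k = v_{φk} − w` tend to zero». This file PROVES both from the weak (distributional) convergence
`r_k ⇀ 0` at the level of `curl r_k`, `∂ⱼ r_k`, `∂ⱼ curl r_k`, tested against continuous compactly supported fields — via the
density upgrade `tendsto_integral_inner_of_testFields` (`…SeqCoreWeakPairing`), the uniform `L²` bounds `Z(r_k) ≤ 2 + 2Z(w)`,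
`Pal(r_k) ≤ 2 + 2Pal(w)`, `‖Dr_k‖₂² ≤ Z(r_k)` and the uniform `L⁴` bound on `curl r_k` (Ladyzhenskaya):

* `tendsto_pairing_curl_of_testFields`, `tendsto_pairing_fderiv_curl_of_testFields` — census item (b);
* `tendsto_linear_mixed_of_testFields` — census item (c')-lin: `T(r_k,w,w) + T(w,r_k,w) + T(w,w,r_k) → 0`
  (`T(a,b,c) = ∫⟪curl a, Db (curl c)⟫`; first/third term in `L⁴/L^{4/3}` with `Dw(curl w), (Dw)†(curl w) ∈ L^{4/3}`, second in
  `L²/L²` after `⟪θ, Dr θ⟫ = Σⱼ ⟪∂ⱼ r, θⱼ • θ⟫`);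
* `compact_of_centredLocalTestFieldLimit`, `nearSaturationNearMaximiser_of_centredLocalTestFieldLimit` — BY NAME: stmt-25482 ⟸
  (P_w'') = ∃ admissible `w`, subsequence: (a) local `L²` convergence of the vorticity on the centring ball, (b'') weak convergence
  of `curl`, `∂ⱼ`, `∂ⱼ curl` of `v_{φk} − w` against `C_c` test fields, (c'-quad) the three QUADRATIC mixed terms → 0.

HONEST FRAMING: (P_w'') — local Rellich on a ball, extraction AND IDENTIFICATION of the weak limit with an ADMISSIBLE (smooth) `w`
(regularity of Lu–Doering extremising profiles), and the quadratic mixed terms — is NOT proved here; stmt-25482, `LerayFloorGap`,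
`ProductionEfficiencyDecay` (stmt-22866) and Navier–Stokes regularity stay OPEN; no summit statement is proved. [folklore]
-/

-- the problem directory repeats the summit name (`NavierStokesRegularity/NavierStokesRegularity`)
set_option linter.dupNamespace false

noncomputable section

namespace Summit.NavierStokesRegularity.NavierStokesRegularity.Theorems

namespace NearSaturationNearMaximiser

namespace SeqCore

open Set MeasureTheory Filter Topology Function
open scoped InnerProductSpace ENNReal NNReal
open Literature.Analysis.FluidPDE
open Magsanop2026Enstrophy (slice_integrable)

/-! ## §1 The weak pairings (census item (b)) from weak convergence against test fields -/

/-- **Weak pairing of the vorticity.** Along admissible `u_k` with `Z(u_k) ≤ M_Z` and an admissible `w`, if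
`curl (u_k − w) ⇀ 0` against continuous compactly supported fields, then `∫⟪curl u_k, curl w⟫ → Z(w)`
(density upgrade in `L²`, `curl w ∈ L²`). [folklore] -/
theorem tendsto_pairing_curl_of_testFields {u : ℕ → EuclideanSpace ℝ (Fin 3) → EuclideanSpace ℝ (Fin 3)}
    {w : EuclideanSpace ℝ (Fin 3) → EuclideanSpace ℝ (Fin 3)} {MZ : ℝ}
    (hu : ∀ k, ContDiff ℝ (⊤ : ℕ∞) (u k) ∧ VectorCalculus.IsDivFree (u k) ∧ (∫⁻ x, ‖iteratedFDeriv ℝ 0 (u k) x‖ₑ ^ 2 < ⊤) ∧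
      (∫⁻ x, ‖iteratedFDeriv ℝ 1 (u k) x‖ₑ ^ 2 < ⊤) ∧ (∫⁻ x, ‖iteratedFDeriv ℝ 2 (u k) x‖ₑ ^ 2 < ⊤))
    (hw : ContDiff ℝ (⊤ : ℕ∞) w ∧ VectorCalculus.IsDivFree w ∧ (∫⁻ x, ‖iteratedFDeriv ℝ 0 w x‖ₑ ^ 2 < ⊤) ∧
      (∫⁻ x, ‖iteratedFDeriv ℝ 1 w x‖ₑ ^ 2 < ⊤) ∧ (∫⁻ x, ‖iteratedFDeriv ℝ 2 w x‖ₑ ^ 2 < ⊤))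
    (hZ : ∀ k, ∫ x, ‖curl (u k) x‖ ^ 2 ≤ MZ)
    (hW1 : ∀ ψ : EuclideanSpace ℝ (Fin 3) → EuclideanSpace ℝ (Fin 3), Continuous ψ → HasCompactSupport ψ →
      Tendsto (fun k => ∫ x, ⟪curl (u k - w) x, ψ x⟫_ℝ) atTop (𝓝 0)) :
    Tendsto (fun k => ∫ x, ⟪curl (u k) x, curl w x⟫_ℝ) atTop (𝓝 (∫ x, ‖curl w x‖ ^ 2)) := by
  have hr := fun k => admissible_sub (hu k) hw
  -- the density upgrade: `∫⟪curl (u_k − w), curl w⟫ → 0`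
  have hT : Tendsto (fun k => ∫ x, ⟪curl (u k - w) x, curl w x⟫_ℝ) atTop (𝓝 0) := by
    refine tendsto_integral_inner_of_testFields holderConjugate_two (C := 2 * MZ + 2 * ∫ x, ‖curl w x‖ ^ 2)
      (fun k => memLp_two_curl (hr k).1 (hr k).2.2.2.1) (fun k => ?_) (fun ψ hψ hψc _ => hW1 ψ hψ hψc)
      (memLp_two_curl hw.1 hw.2.2.2.1)
    rw [integral_norm_rpow_natCast]
    exact (enstrophy_sub_le (hu k).1 hw.1 (hu k).2.2.2.1 hw.2.2.2.1).trans (by linarith [hZ k])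
  -- `⟪curl u_k, curl w⟫ = ⟪curl (u_k − w), curl w⟫ + ‖curl w‖²`
  have Iw := (integrable_norm_curl_sq (hw.1.of_le (by norm_cast)) hw.2.2.2.1).1
  have hId : ∀ k, Integrable (fun x => ⟪curl (u k - w) x, curl w x⟫_ℝ) := fun k =>
    integrable_inner_of_memLp holderConjugate_two (memLp_two_curl (hr k).1 (hr k).2.2.2.1) (memLp_two_curl hw.1 hw.2.2.2.1)
  have heq : ∀ k, (∫ x, ⟪curl (u k) x, curl w x⟫_ℝ) = (∫ x, ⟪curl (u k - w) x, curl w x⟫_ℝ) + ∫ x, ‖curl w x‖ ^ 2 := by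
    intro k
    rw [← integral_add (hId k) Iw]
    refine integral_congr_ae (ae_of_all _ fun x => ?_)
    have hc : curl (u k - w) x = curl (u k) x - curl w x :=
      congrFun (curl_sub_eq ((hu k).1.differentiable (by simp)) (hw.1.differentiable (by simp))) x
    show ⟪curl (u k) x, curl w x⟫_ℝ = ⟪curl (u k - w) x, curl w x⟫_ℝ + ‖curl w x‖ ^ 2
    rw [hc, inner_sub_left, real_inner_self_eq_norm_sq]; ring
  have hlim := hT.add_const (∫ x, ‖curl w x‖ ^ 2)
  rw [zero_add] at hlim
  exact hlim.congr fun k => (heq k).symm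

/-- `D(curl (f − g)) = D(curl f) − D(curl g)` pointwise for smooth fields. [folklore] -/
theorem fderiv_curl_sub_apply {f g : EuclideanSpace ℝ (Fin 3) → EuclideanSpace ℝ (Fin 3)} (hf : ContDiff ℝ (⊤ : ℕ∞) f)
    (hg : ContDiff ℝ (⊤ : ℕ∞) g) (x : EuclideanSpace ℝ (Fin 3)) :
    fderiv ℝ (curl (f - g)) x = fderiv ℝ (curl f) x - fderiv ℝ (curl g) x := by
  have hcf : ContDiff ℝ 1 (curl f) := contDiff_curl (n := 1) (hf.of_le (by norm_cast))
  have hcg : ContDiff ℝ 1 (curl g) := contDiff_curl (n := 1) (hg.of_le (by norm_cast))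
  rw [curl_sub_eq (hf.differentiable (by simp)) (hg.differentiable (by simp))]
  exact fderiv_fun_sub ((hcf.differentiable one_ne_zero) x) ((hcg.differentiable one_ne_zero) x)

/-- **Weak pairing of the vorticity gradient.** Along admissible `u_k` with `Pal(u_k) ≤ M_P` and an admissible `w`, if each
`∂ⱼ curl (u_k − w) ⇀ 0` against continuous compactly supported fields, then
`∫ Σᵢ ⟪D curl u_k eᵢ, D curl w eᵢ⟫ → Pal(w)` (density upgrade in `L²`, `∂ᵢ curl w ∈ L²`). [folklore] -/
theorem tendsto_pairing_fderiv_curl_of_testFields {u : ℕ → EuclideanSpace ℝ (Fin 3) → EuclideanSpace ℝ (Fin 3)}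
    {w : EuclideanSpace ℝ (Fin 3) → EuclideanSpace ℝ (Fin 3)} {MP : ℝ}
    (hu : ∀ k, ContDiff ℝ (⊤ : ℕ∞) (u k) ∧ VectorCalculus.IsDivFree (u k) ∧ (∫⁻ x, ‖iteratedFDeriv ℝ 0 (u k) x‖ₑ ^ 2 < ⊤) ∧
      (∫⁻ x, ‖iteratedFDeriv ℝ 1 (u k) x‖ₑ ^ 2 < ⊤) ∧ (∫⁻ x, ‖iteratedFDeriv ℝ 2 (u k) x‖ₑ ^ 2 < ⊤))
    (hw : ContDiff ℝ (⊤ : ℕ∞) w ∧ VectorCalculus.IsDivFree w ∧ (∫⁻ x, ‖iteratedFDeriv ℝ 0 w x‖ₑ ^ 2 < ⊤) ∧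
      (∫⁻ x, ‖iteratedFDeriv ℝ 1 w x‖ₑ ^ 2 < ⊤) ∧ (∫⁻ x, ‖iteratedFDeriv ℝ 2 w x‖ₑ ^ 2 < ⊤))
    (hP : ∀ k, ∫ x, frobeniusNormSq (fderiv ℝ (curl (u k)) x) ≤ MP)
    (hW3 : ∀ (j : Fin 3) (ψ : EuclideanSpace ℝ (Fin 3) → EuclideanSpace ℝ (Fin 3)), Continuous ψ → HasCompactSupport ψ →
      Tendsto (fun k => ∫ x, ⟪fderiv ℝ (curl (u k - w)) x (EuclideanSpace.basisFun (Fin 3) ℝ j), ψ x⟫_ℝ) atTop (𝓝 0)) :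
    Tendsto (fun k => ∫ x, ∑ i, ⟪fderiv ℝ (curl (u k)) x (EuclideanSpace.basisFun (Fin 3) ℝ i),
        fderiv ℝ (curl w) x (EuclideanSpace.basisFun (Fin 3) ℝ i)⟫_ℝ) atTop
      (𝓝 (∫ x, frobeniusNormSq (fderiv ℝ (curl w) x))) := by
  have hr := fun k => admissible_sub (hu k) hw
  set e : Fin 3 → EuclideanSpace ℝ (Fin 3) := fun i => EuclideanSpace.basisFun (Fin 3) ℝ i with he
  -- each column pairing `∫⟪∂ᵢ curl (u_k − w), ∂ᵢ curl w⟫ → 0`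
  have hT : ∀ i, Tendsto (fun k => ∫ x, ⟪fderiv ℝ (curl (u k - w)) x (e i), fderiv ℝ (curl w) x (e i)⟫_ℝ) atTop (𝓝 0) := by
    intro i
    refine tendsto_integral_inner_of_testFields holderConjugate_two
      (C := 2 * MP + 2 * ∫ x, frobeniusNormSq (fderiv ℝ (curl w) x))
      (fun k => (memLp_two_fderiv_curl_apply (hr k).1 (hr k).2.2.2.1 (hr k).2.2.2.2 i).2.2) (fun k => ?_)
      (fun ψ hψ hψc _ => hW3 i ψ hψ hψc) (memLp_two_fderiv_curl_apply hw.1 hw.2.2.2.1 hw.2.2.2.2 i).2.2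
    rw [integral_norm_rpow_natCast]
    exact (memLp_two_fderiv_curl_apply (hr k).1 (hr k).2.2.2.1 (hr k).2.2.2.2 i).2.1.trans
      ((palinstrophy_sub_le (hu k).1 hw.1 (hu k).2.2.2.2 hw.2.2.2.2).trans (by linarith [hP k]))
  have hsum := tendsto_finsetSum (Finset.univ : Finset (Fin 3)) fun i _ => hT i
  simp only [Finset.sum_const_zero] at hsum
  -- integrability
  have IF := (integrable_frobeniusNormSq_fderiv_curl (hw.1.of_le (by norm_cast) : ContDiff ℝ 3 w) hw.2.2.2.2).1
  have hIi : ∀ k i, Integrable (fun x => ⟪fderiv ℝ (curl (u k - w)) x (e i), fderiv ℝ (curl w) x (e i)⟫_ℝ) := fun k i =>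
    integrable_inner_of_memLp holderConjugate_two (memLp_two_fderiv_curl_apply (hr k).1 (hr k).2.2.2.1 (hr k).2.2.2.2 i).2.2
      (memLp_two_fderiv_curl_apply hw.1 hw.2.2.2.1 hw.2.2.2.2 i).2.2
  have heq : ∀ k, (∫ x, ∑ i, ⟪fderiv ℝ (curl (u k)) x (e i), fderiv ℝ (curl w) x (e i)⟫_ℝ) =
      (∑ i, ∫ x, ⟪fderiv ℝ (curl (u k - w)) x (e i), fderiv ℝ (curl w) x (e i)⟫_ℝ) +
        ∫ x, frobeniusNormSq (fderiv ℝ (curl w) x) := by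
    intro k
    rw [← integral_finsetSum _ (fun i _ => hIi k i), ← integral_add (integrable_finsetSum _ fun i _ => hIi k i) IF]
    refine integral_congr_ae (ae_of_all _ fun x => ?_)
    show (∑ i, ⟪fderiv ℝ (curl (u k)) x (e i), fderiv ℝ (curl w) x (e i)⟫_ℝ) =
      (∑ i, ⟪fderiv ℝ (curl (u k - w)) x (e i), fderiv ℝ (curl w) x (e i)⟫_ℝ) + frobeniusNormSq (fderiv ℝ (curl w) x)
    rw [frobeniusNormSq_eq_sum (EuclideanSpace.basisFun (Fin 3) ℝ), ← Finset.sum_add_distrib]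
    refine Finset.sum_congr rfl fun i _ => ?_
    have hD : fderiv ℝ (curl (u k)) x = fderiv ℝ (curl (u k - w)) x + fderiv ℝ (curl w) x := by
      rw [fderiv_curl_sub_apply (hu k).1 hw.1 x, sub_add_cancel]
    rw [hD, add_apply, inner_add_left, real_inner_self_eq_norm_sq]
  have hlim := hsum.add_const (∫ x, frobeniusNormSq (fderiv ℝ (curl w) x))
  rw [zero_add] at hlim
  exact hlim.congr fun k => (heq k).symm

/-! ## §2 The three LINEAR mixed stretching terms (census item (c')-lin) -/

/-- `⟪θ, A θ⟫ = Σⱼ ⟪A eⱼ, θⱼ • θ⟫` (expand the argument of `A` in the standard basis). [folklore] -/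
theorem inner_apply_self_eq_sum (θ : EuclideanSpace ℝ (Fin 3)) (A : EuclideanSpace ℝ (Fin 3) →L[ℝ] EuclideanSpace ℝ (Fin 3)) :
    ⟪θ, A θ⟫_ℝ = ∑ j, ⟪A (EuclideanSpace.basisFun (Fin 3) ℝ j), θ j • θ⟫_ℝ := by
  have h : A θ = ∑ j, θ j • A (EuclideanSpace.basisFun (Fin 3) ℝ j) := by
    conv_lhs => rw [← (EuclideanSpace.basisFun (Fin 3) ℝ).sum_repr θ]
    simp only [EuclideanSpace.basisFun_repr, map_sum, map_smul]
  rw [h, inner_sum]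
  refine Finset.sum_congr rfl fun j _ => ?_
  rw [real_inner_smul_right, real_inner_smul_right, real_inner_comm]

/-- **The linear mixed terms vanish in the limit.** Along admissible `u_k` with `Z(u_k) ≤ M_Z`, `Pal(u_k) ≤ M_P` and an
admissible `w`, if `curl (u_k − w) ⇀ 0` and each `∂ⱼ(u_k − w) ⇀ 0` against continuous compactly supported fields, then the
three mixed trilinear stretching terms linear in `r_k = u_k − w` tend to zero:
`T(r_k,w,w) + T(w,r_k,w) + T(w,w,r_k) → 0` — the first and third by the density upgrade in `L⁴/L^{4/3}`
(`curl r_k` bounded in `L⁴` by Ladyzhenskaya, `Dw(curl w), (Dw)†(curl w) ∈ L^{4/3}`), the second in `L²/L²`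
(`∂ⱼ r_k` bounded in `L²`, `(curl w)ⱼ • curl w ∈ L²`). [folklore] -/
theorem tendsto_linear_mixed_of_testFields {u : ℕ → EuclideanSpace ℝ (Fin 3) → EuclideanSpace ℝ (Fin 3)}
    {w : EuclideanSpace ℝ (Fin 3) → EuclideanSpace ℝ (Fin 3)} {MZ MP : ℝ}
    (hu : ∀ k, ContDiff ℝ (⊤ : ℕ∞) (u k) ∧ VectorCalculus.IsDivFree (u k) ∧ (∫⁻ x, ‖iteratedFDeriv ℝ 0 (u k) x‖ₑ ^ 2 < ⊤) ∧
      (∫⁻ x, ‖iteratedFDeriv ℝ 1 (u k) x‖ₑ ^ 2 < ⊤) ∧ (∫⁻ x, ‖iteratedFDeriv ℝ 2 (u k) x‖ₑ ^ 2 < ⊤))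
    (hw : ContDiff ℝ (⊤ : ℕ∞) w ∧ VectorCalculus.IsDivFree w ∧ (∫⁻ x, ‖iteratedFDeriv ℝ 0 w x‖ₑ ^ 2 < ⊤) ∧
      (∫⁻ x, ‖iteratedFDeriv ℝ 1 w x‖ₑ ^ 2 < ⊤) ∧ (∫⁻ x, ‖iteratedFDeriv ℝ 2 w x‖ₑ ^ 2 < ⊤))
    (hZ : ∀ k, ∫ x, ‖curl (u k) x‖ ^ 2 ≤ MZ) (hP : ∀ k, ∫ x, frobeniusNormSq (fderiv ℝ (curl (u k)) x) ≤ MP)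
    (hW1 : ∀ ψ : EuclideanSpace ℝ (Fin 3) → EuclideanSpace ℝ (Fin 3), Continuous ψ → HasCompactSupport ψ →
      Tendsto (fun k => ∫ x, ⟪curl (u k - w) x, ψ x⟫_ℝ) atTop (𝓝 0))
    (hW2 : ∀ (j : Fin 3) (ψ : EuclideanSpace ℝ (Fin 3) → EuclideanSpace ℝ (Fin 3)), Continuous ψ → HasCompactSupport ψ →
      Tendsto (fun k => ∫ x, ⟪fderiv ℝ (u k - w) x (EuclideanSpace.basisFun (Fin 3) ℝ j), ψ x⟫_ℝ) atTop (𝓝 0)) :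
    Tendsto (fun k => (∫ x, ⟪curl (u k - w) x, fderiv ℝ w x (curl w x)⟫_ℝ) +
      (∫ x, ⟪curl w x, fderiv ℝ (u k - w) x (curl w x)⟫_ℝ) + (∫ x, ⟪curl w x, fderiv ℝ w x (curl (u k - w) x)⟫_ℝ))
      atTop (𝓝 0) := by
  have hr := fun k => admissible_sub (hu k) hw
  set e : Fin 3 → EuclideanSpace ℝ (Fin 3) := fun i => EuclideanSpace.basisFun (Fin 3) ℝ i with he
  -- uniform bounds along `r_k = u_k − w`
  set CZ : ℝ := 2 * MZ + 2 * ∫ x, ‖curl w x‖ ^ 2 with hCZ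
  set CP : ℝ := 2 * MP + 2 * ∫ x, frobeniusNormSq (fderiv ℝ (curl w) x) with hCP
  have hZr : ∀ k, ∫ x, ‖curl (u k - w) x‖ ^ 2 ≤ CZ := fun k =>
    (enstrophy_sub_le (hu k).1 hw.1 (hu k).2.2.2.1 hw.2.2.2.1).trans (by linarith [hZ k])
  have hPr : ∀ k, ∫ x, frobeniusNormSq (fderiv ℝ (curl (u k - w)) x) ≤ CP := fun k =>
    (palinstrophy_sub_le (hu k).1 hw.1 (hu k).2.2.2.2 hw.2.2.2.2).trans (by linarith [hP k])
  have hCZ0 : 0 ≤ CZ := (integral_nonneg fun x => by positivity).trans (hZr 0)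
  have hCP0 : 0 ≤ CP := (integral_nonneg fun x => frobeniusNormSq_nonneg _).trans (hPr 0)
  set K : ℝ := (SNormLESNormFDerivOfEqConst (EuclideanSpace ℝ (Fin 3)) (volume : Measure (EuclideanSpace ℝ (Fin 3))) 2 : ℝ)
    with hK
  have hK0 : 0 ≤ K := NNReal.coe_nonneg _
  have h4r : ∀ k, ∫ x, ‖curl (u k - w) x‖ ^ 4 ≤ K ^ 3 * Real.sqrt CZ * (CP * Real.sqrt CP) := by
    intro k
    refine (integral_curl_pow_four_le' (hr k).1 (hr k).2.2.2.1 (hr k).2.2.2.2).trans ?_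
    have hP0 : 0 ≤ ∫ x, frobeniusNormSq (fderiv ℝ (curl (u k - w)) x) := integral_nonneg fun x => frobeniusNormSq_nonneg _
    gcongr
    · exact hZr k
    · exact hPr k
    · exact hPr k
  -- (L1) `∫⟪curl r_k, Dw (curl w)⟫ → 0`
  have hL1 : Tendsto (fun k => ∫ x, ⟪curl (u k - w) x, fderiv ℝ w x (curl w x)⟫_ℝ) atTop (𝓝 0) := by
    refine tendsto_integral_inner_of_testFields holderConjugate_four (C := K ^ 3 * Real.sqrt CZ * (CP * Real.sqrt CP))
      (fun k => memLp_four_curl (hr k).1 (hr k).2.2.2.1 (hr k).2.2.2.2) (fun k => ?_)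
      (fun ψ hψ hψc _ => hW1 ψ hψ hψc) (memLp_fderiv_apply_curl hw.1 hw.2.2.2.1 hw.2.2.2.2)
    rw [integral_norm_rpow_natCast]
    exact h4r k
  -- (L3) `∫⟪curl w, Dw (curl r_k)⟫ = ∫⟪curl r_k, (Dw)† curl w⟫ → 0`
  have hL3 : Tendsto (fun k => ∫ x, ⟪curl w x, fderiv ℝ w x (curl (u k - w) x)⟫_ℝ) atTop (𝓝 0) := by
    have h := tendsto_integral_inner_of_testFields holderConjugate_four (C := K ^ 3 * Real.sqrt CZ * (CP * Real.sqrt CP))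
      (fun k => memLp_four_curl (hr k).1 (hr k).2.2.2.1 (hr k).2.2.2.2) (fun k => by
        rw [integral_norm_rpow_natCast]; exact h4r k)
      (fun ψ hψ hψc _ => hW1 ψ hψ hψc) (memLp_adjoint_fderiv_apply_curl hw.1 hw.2.2.2.1 hw.2.2.2.2)
    refine h.congr fun k => integral_congr_ae (ae_of_all _ fun x => ?_)
    show ⟪curl (u k - w) x, ContinuousLinearMap.adjoint (fderiv ℝ w x) (curl w x)⟫_ℝ =
      ⟪curl w x, fderiv ℝ w x (curl (u k - w) x)⟫_ℝ
    rw [real_inner_comm, ContinuousLinearMap.adjoint_inner_left]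
  -- (L2) `∫⟪curl w, Dr_k (curl w)⟫ = Σⱼ ∫⟪∂ⱼ r_k, (curl w)ⱼ • curl w⟫ → 0`
  have hT2 : ∀ j, Tendsto (fun k => ∫ x, ⟪fderiv ℝ (u k - w) x (e j), (curl w x) j • curl w x⟫_ℝ) atTop (𝓝 0) := by
    intro j
    refine tendsto_integral_inner_of_testFields holderConjugate_two (C := CZ)
      (fun k => (memLp_two_fderiv_apply (hr k).1 (hr k).2.2.2.1 (hr k).2.2.2.2
        (e := e j) (by rw [he]; simp)).2.2) (fun k => ?_)
      (fun ψ hψ hψc _ => hW2 j ψ hψ hψc) (memLp_coord_smul_curl hw.1 hw.2.2.2.1 hw.2.2.2.2 j)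
    rw [integral_norm_rpow_natCast]
    exact ((memLp_two_fderiv_apply (hr k).1 (hr k).2.2.2.1 (hr k).2.2.2.2 (e := e j) (by rw [he]; simp)).2.1.trans
      (integral_norm_fderiv_sq_le_enstrophy (hr k))).trans (hZr k)
  have hsum2 := tendsto_finsetSum (Finset.univ : Finset (Fin 3)) fun j _ => hT2 j
  simp only [Finset.sum_const_zero] at hsum2
  have hI2 : ∀ k j, Integrable (fun x => ⟪fderiv ℝ (u k - w) x (e j), (curl w x) j • curl w x⟫_ℝ) := fun k j =>
    integrable_inner_of_memLp holderConjugate_two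
      (memLp_two_fderiv_apply (hr k).1 (hr k).2.2.2.1 (hr k).2.2.2.2 (e := e j) (by rw [he]; simp)).2.2
      (memLp_coord_smul_curl hw.1 hw.2.2.2.1 hw.2.2.2.2 j)
  have hL2 : Tendsto (fun k => ∫ x, ⟪curl w x, fderiv ℝ (u k - w) x (curl w x)⟫_ℝ) atTop (𝓝 0) := by
    refine hsum2.congr fun k => ?_
    rw [← integral_finsetSum _ (fun j _ => hI2 k j)]
    refine integral_congr_ae (ae_of_all _ fun x => ?_)
    exact (inner_apply_self_eq_sum (curl w x) (fderiv ℝ (u k - w) x)).symm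
  have h := (hL1.add hL2).add hL3
  rw [add_zero, add_zero] at h
  exact h

/-! ## §3 By name: (P_w') from weak convergence against test fields -/

/-- **COMPACTNESS from centred local limits with weak convergence against test fields.** As
`compact_of_centredLocalWeakLimitMixed` (`…SeqCoreSplitting`), with the weak-pairing clauses (b) and the vanishing of the three
LINEAR mixed terms replaced by the weak (distributional) convergence `v_{φk} − w ⇀ 0` at the level of `curl`, `∂ⱼ` and
`∂ⱼ curl`, tested against continuous compactly supported fields. [folklore] -/
theorem compact_of_centredLocalTestFieldLimit {c : ℝ} (hc : 0 < c)
    (hadm : ∀ f : EuclideanSpace ℝ (Fin 3) → EuclideanSpace ℝ (Fin 3), (ContDiff ℝ (⊤ : ℕ∞) f ∧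
      Literature.Analysis.FluidPDE.VectorCalculus.IsDivFree f ∧ (∫⁻ x, ‖iteratedFDeriv ℝ 0 f x‖ₑ ^ 2 < ⊤) ∧
      (∫⁻ x, ‖iteratedFDeriv ℝ 1 f x‖ₑ ^ 2 < ⊤) ∧ (∫⁻ x, ‖iteratedFDeriv ℝ 2 f x‖ₑ ^ 2 < ⊤)) → (∫ x,
      ⟪Literature.Analysis.FluidPDE.curl f x, fderiv ℝ f x (Literature.Analysis.FluidPDE.curl f x)⟫_ℝ) ≤ c *
      (∫ x, ‖Literature.Analysis.FluidPDE.curl f x‖ ^ 2) ^ (3 / 4 : ℝ) * (∫ x,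
      Literature.Analysis.FluidPDE.frobeniusNormSq (fderiv ℝ (Literature.Analysis.FluidPDE.curl f) x)) ^ (3 / 4 : ℝ))
    (HWt : ∀ K δ : ℝ, 0 < K → 0 < δ → ∀ v : ℕ → EuclideanSpace ℝ (Fin 3) → EuclideanSpace ℝ (Fin 3),
      (∀ n, (ContDiff ℝ (⊤ : ℕ∞) (v n) ∧
      Literature.Analysis.FluidPDE.VectorCalculus.IsDivFree (v n) ∧ (∫⁻ x, ‖iteratedFDeriv ℝ 0 (v n) x‖ₑ ^ 2 < ⊤) ∧
      (∫⁻ x, ‖iteratedFDeriv ℝ 1 (v n) x‖ₑ ^ 2 < ⊤) ∧ (∫⁻ x, ‖iteratedFDeriv ℝ 2 (v n) x‖ₑ ^ 2 < ⊤))) →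
      (∀ n, (∫ x, ‖Literature.Analysis.FluidPDE.curl (v n) x‖ ^ 2) = 1) →
      (∀ n, (∫ x, Literature.Analysis.FluidPDE.frobeniusNormSq (fderiv ℝ (Literature.Analysis.FluidPDE.curl (v n)) x)) = 1) →
      Tendsto (fun n => ∫ x, ⟪Literature.Analysis.FluidPDE.curl (v n) x, fderiv ℝ (v n) x
        (Literature.Analysis.FluidPDE.curl (v n) x)⟫_ℝ) atTop (𝓝 c) →
      (∀ᶠ n in atTop, δ ≤ ∫ x in Metric.ball (0 : EuclideanSpace ℝ (Fin 3)) K, ‖Literature.Analysis.FluidPDE.curl (v n) x‖ ^ 2) →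
      ∃ w : EuclideanSpace ℝ (Fin 3) → EuclideanSpace ℝ (Fin 3), (ContDiff ℝ (⊤ : ℕ∞) w ∧
      Literature.Analysis.FluidPDE.VectorCalculus.IsDivFree w ∧ (∫⁻ x, ‖iteratedFDeriv ℝ 0 w x‖ₑ ^ 2 < ⊤) ∧
      (∫⁻ x, ‖iteratedFDeriv ℝ 1 w x‖ₑ ^ 2 < ⊤) ∧ (∫⁻ x, ‖iteratedFDeriv ℝ 2 w x‖ₑ ^ 2 < ⊤)) ∧
        ∃ φ : ℕ → ℕ, StrictMono φ ∧
        Tendsto (fun k => ∫ x in Metric.ball (0 : EuclideanSpace ℝ (Fin 3)) K,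
          ‖Literature.Analysis.FluidPDE.curl (v (φ k) - w) x‖ ^ 2) atTop (𝓝 0) ∧
        (∀ ψ : EuclideanSpace ℝ (Fin 3) → EuclideanSpace ℝ (Fin 3), Continuous ψ → HasCompactSupport ψ →
          Tendsto (fun k => ∫ x, ⟪Literature.Analysis.FluidPDE.curl (v (φ k) - w) x, ψ x⟫_ℝ) atTop (𝓝 0)) ∧
        (∀ (j : Fin 3) (ψ : EuclideanSpace ℝ (Fin 3) → EuclideanSpace ℝ (Fin 3)), Continuous ψ → HasCompactSupport ψ →
          Tendsto (fun k => ∫ x, ⟪fderiv ℝ (v (φ k) - w) x (EuclideanSpace.basisFun (Fin 3) ℝ j), ψ x⟫_ℝ) atTop (𝓝 0)) ∧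
        (∀ (j : Fin 3) (ψ : EuclideanSpace ℝ (Fin 3) → EuclideanSpace ℝ (Fin 3)), Continuous ψ → HasCompactSupport ψ →
          Tendsto (fun k => ∫ x, ⟪fderiv ℝ (Literature.Analysis.FluidPDE.curl (v (φ k) - w)) x
            (EuclideanSpace.basisFun (Fin 3) ℝ j), ψ x⟫_ℝ) atTop (𝓝 0)) ∧
        Tendsto (fun k => (∫ x, ⟪Literature.Analysis.FluidPDE.curl (v (φ k) - w) x, fderiv ℝ (v (φ k) - w) x (Literature.Analysis.FluidPDE.curl w x)⟫_ℝ) +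
          (∫ x, ⟪Literature.Analysis.FluidPDE.curl (v (φ k) - w) x, fderiv ℝ w x (Literature.Analysis.FluidPDE.curl (v (φ k) - w) x)⟫_ℝ) +
          (∫ x, ⟪Literature.Analysis.FluidPDE.curl w x, fderiv ℝ (v (φ k) - w) x (Literature.Analysis.FluidPDE.curl (v (φ k) - w) x)⟫_ℝ)) atTop (𝓝 0)) :
    ∀ v : ℕ → EuclideanSpace ℝ (Fin 3) → EuclideanSpace ℝ (Fin 3),
      (∀ n, (ContDiff ℝ (⊤ : ℕ∞) (v n) ∧
      Literature.Analysis.FluidPDE.VectorCalculus.IsDivFree (v n) ∧ (∫⁻ x, ‖iteratedFDeriv ℝ 0 (v n) x‖ₑ ^ 2 < ⊤) ∧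
      (∫⁻ x, ‖iteratedFDeriv ℝ 1 (v n) x‖ₑ ^ 2 < ⊤) ∧ (∫⁻ x, ‖iteratedFDeriv ℝ 2 (v n) x‖ₑ ^ 2 < ⊤))) →
      (∀ n, (∫ x, ‖Literature.Analysis.FluidPDE.curl (v n) x‖ ^ 2) = 1) →
      (∀ n, (∫ x, Literature.Analysis.FluidPDE.frobeniusNormSq (fderiv ℝ (Literature.Analysis.FluidPDE.curl (v n)) x)) = 1) →
      Tendsto (fun n => ∫ x, ⟪Literature.Analysis.FluidPDE.curl (v n) x, fderiv ℝ (v n) x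
        (Literature.Analysis.FluidPDE.curl (v n) x)⟫_ℝ) atTop (𝓝 c) →
      ∃ w : EuclideanSpace ℝ (Fin 3) → EuclideanSpace ℝ (Fin 3), (ContDiff ℝ (⊤ : ℕ∞) w ∧
      Literature.Analysis.FluidPDE.VectorCalculus.IsDivFree w ∧ (∫⁻ x, ‖iteratedFDeriv ℝ 0 w x‖ₑ ^ 2 < ⊤) ∧
      (∫⁻ x, ‖iteratedFDeriv ℝ 1 w x‖ₑ ^ 2 < ⊤) ∧ (∫⁻ x, ‖iteratedFDeriv ℝ 2 w x‖ₑ ^ 2 < ⊤)) ∧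
        ∃ (a : ℕ → EuclideanSpace ℝ (Fin 3)) (φ : ℕ → ℕ), StrictMono φ ∧
        Tendsto (fun k => ∫ x, ‖Literature.Analysis.FluidPDE.curl ((fun x => v (φ k) (x - a k)) - w) x‖ ^ 2) atTop (𝓝 0) ∧
        Tendsto (fun k => ∫ x, Literature.Analysis.FluidPDE.frobeniusNormSq (fderiv ℝ
          (Literature.Analysis.FluidPDE.curl ((fun x => v (φ k) (x - a k)) - w)) x)) atTop (𝓝 0) := by
  refine compact_of_centredLocalWeakLimitMixed hc hadm fun K δ hK hδ v hAdm hZ1 hP1 hS hcen => ?_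
  obtain ⟨w, hw, φ, hφ, hloc, hW1, hW2, hW3, hquad⟩ := HWt K δ hK hδ v hAdm hZ1 hP1 hS hcen
  have hu : ∀ k, ContDiff ℝ (⊤ : ℕ∞) (v (φ k)) ∧ VectorCalculus.IsDivFree (v (φ k)) ∧
      (∫⁻ x, ‖iteratedFDeriv ℝ 0 (v (φ k)) x‖ₑ ^ 2 < ⊤) ∧ (∫⁻ x, ‖iteratedFDeriv ℝ 1 (v (φ k)) x‖ₑ ^ 2 < ⊤) ∧
      (∫⁻ x, ‖iteratedFDeriv ℝ 2 (v (φ k)) x‖ₑ ^ 2 < ⊤) := fun k => hAdm (φ k)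
  have hZ : ∀ k, ∫ x, ‖curl (v (φ k)) x‖ ^ 2 ≤ 1 := fun k => (hZ1 (φ k)).le
  have hP : ∀ k, ∫ x, frobeniusNormSq (fderiv ℝ (curl (v (φ k))) x) ≤ 1 := fun k => (hP1 (φ k)).le
  exact ⟨w, hw, φ, hφ, hloc, tendsto_pairing_curl_of_testFields hu hw hZ hW1,
    tendsto_pairing_fderiv_curl_of_testFields hu hw hP hW3, tendsto_linear_mixed_of_testFields hu hw hZ hP hW1 hW2, hquad⟩

/-- **`NearSaturationNearMaximiser` (stmt-25482) from centred local limits with weak convergence against test fields, BY NAME.**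
Assumed, for the sharp constant: (P_w'') — every centred admissible sequence with `Z = Pal = 1`, `S → c⋆` has a subsequence
`v_{φ k}` and an ADMISSIBLE `w` with (a) local `L²` convergence of the vorticity on the centring ball (Rellich), (b'') the weak
(distributional) convergence `v_{φk} − w ⇀ 0` of `curl`, `∂ⱼ`, `∂ⱼ curl` against continuous compactly supported fields
(Banach–Alaoglu + identification of the limit), and (c'-quad) the three QUADRATIC mixed trilinear stretching terms tending to `0`
(local compactness + tails of `w`). PROVED here from (b''): the weak pairings (b) and the vanishing of the three LINEAR mixed terms
(density upgrade). NOT proved: (P_w''). [folklore] -/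
theorem nearSaturationNearMaximiser_of_centredLocalTestFieldLimit
    (HWt : ∀ c : ℝ, (0 < c ∧ (∀ v : EuclideanSpace ℝ (Fin 3) → EuclideanSpace ℝ (Fin 3), (ContDiff ℝ (⊤ : ℕ∞) v ∧
      Literature.Analysis.FluidPDE.VectorCalculus.IsDivFree v ∧ (∫⁻ x, ‖iteratedFDeriv ℝ 0 v x‖ₑ ^ 2 < ⊤) ∧
      (∫⁻ x, ‖iteratedFDeriv ℝ 1 v x‖ₑ ^ 2 < ⊤) ∧ (∫⁻ x, ‖iteratedFDeriv ℝ 2 v x‖ₑ ^ 2 < ⊤)) → (∫ x,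
      ⟪Literature.Analysis.FluidPDE.curl v x, fderiv ℝ v x (Literature.Analysis.FluidPDE.curl v x)⟫_ℝ) ≤ c *
      (∫ x, ‖Literature.Analysis.FluidPDE.curl v x‖ ^ 2) ^ (3 / 4 : ℝ) * (∫ x,
      Literature.Analysis.FluidPDE.frobeniusNormSq (fderiv ℝ (Literature.Analysis.FluidPDE.curl v) x)) ^ (3 / 4 : ℝ)) ∧ ∀ c' : ℝ, (∀ w : EuclideanSpace ℝ (Fin 3) → EuclideanSpace ℝ (Fin 3), (ContDiff ℝ (⊤ : ℕ∞) w ∧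
      Literature.Analysis.FluidPDE.VectorCalculus.IsDivFree w ∧ (∫⁻ x, ‖iteratedFDeriv ℝ 0 w x‖ₑ ^ 2 < ⊤) ∧
      (∫⁻ x, ‖iteratedFDeriv ℝ 1 w x‖ₑ ^ 2 < ⊤) ∧ (∫⁻ x, ‖iteratedFDeriv ℝ 2 w x‖ₑ ^ 2 < ⊤)) → (∫ x,
      ⟪Literature.Analysis.FluidPDE.curl w x, fderiv ℝ w x (Literature.Analysis.FluidPDE.curl w x)⟫_ℝ) ≤ c' *
      (∫ x, ‖Literature.Analysis.FluidPDE.curl w x‖ ^ 2) ^ (3 / 4 : ℝ) * (∫ x,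
      Literature.Analysis.FluidPDE.frobeniusNormSq (fderiv ℝ (Literature.Analysis.FluidPDE.curl w) x)) ^ (3 / 4 : ℝ)) → c ≤ c') →
      ∀ K δ : ℝ, 0 < K → 0 < δ → ∀ v : ℕ → EuclideanSpace ℝ (Fin 3) → EuclideanSpace ℝ (Fin 3),
      (∀ n, (ContDiff ℝ (⊤ : ℕ∞) (v n) ∧
      Literature.Analysis.FluidPDE.VectorCalculus.IsDivFree (v n) ∧ (∫⁻ x, ‖iteratedFDeriv ℝ 0 (v n) x‖ₑ ^ 2 < ⊤) ∧
      (∫⁻ x, ‖iteratedFDeriv ℝ 1 (v n) x‖ₑ ^ 2 < ⊤) ∧ (∫⁻ x, ‖iteratedFDeriv ℝ 2 (v n) x‖ₑ ^ 2 < ⊤))) →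
      (∀ n, (∫ x, ‖Literature.Analysis.FluidPDE.curl (v n) x‖ ^ 2) = 1) →
      (∀ n, (∫ x, Literature.Analysis.FluidPDE.frobeniusNormSq (fderiv ℝ (Literature.Analysis.FluidPDE.curl (v n)) x)) = 1) →
      Tendsto (fun n => ∫ x, ⟪Literature.Analysis.FluidPDE.curl (v n) x, fderiv ℝ (v n) x
        (Literature.Analysis.FluidPDE.curl (v n) x)⟫_ℝ) atTop (𝓝 c) →
      (∀ᶠ n in atTop, δ ≤ ∫ x in Metric.ball (0 : EuclideanSpace ℝ (Fin 3)) K, ‖Literature.Analysis.FluidPDE.curl (v n) x‖ ^ 2) →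
      ∃ w : EuclideanSpace ℝ (Fin 3) → EuclideanSpace ℝ (Fin 3), (ContDiff ℝ (⊤ : ℕ∞) w ∧
      Literature.Analysis.FluidPDE.VectorCalculus.IsDivFree w ∧ (∫⁻ x, ‖iteratedFDeriv ℝ 0 w x‖ₑ ^ 2 < ⊤) ∧
      (∫⁻ x, ‖iteratedFDeriv ℝ 1 w x‖ₑ ^ 2 < ⊤) ∧ (∫⁻ x, ‖iteratedFDeriv ℝ 2 w x‖ₑ ^ 2 < ⊤)) ∧
        ∃ φ : ℕ → ℕ, StrictMono φ ∧
        Tendsto (fun k => ∫ x in Metric.ball (0 : EuclideanSpace ℝ (Fin 3)) K,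
          ‖Literature.Analysis.FluidPDE.curl (v (φ k) - w) x‖ ^ 2) atTop (𝓝 0) ∧
        (∀ ψ : EuclideanSpace ℝ (Fin 3) → EuclideanSpace ℝ (Fin 3), Continuous ψ → HasCompactSupport ψ →
          Tendsto (fun k => ∫ x, ⟪Literature.Analysis.FluidPDE.curl (v (φ k) - w) x, ψ x⟫_ℝ) atTop (𝓝 0)) ∧
        (∀ (j : Fin 3) (ψ : EuclideanSpace ℝ (Fin 3) → EuclideanSpace ℝ (Fin 3)), Continuous ψ → HasCompactSupport ψ →
          Tendsto (fun k => ∫ x, ⟪fderiv ℝ (v (φ k) - w) x (EuclideanSpace.basisFun (Fin 3) ℝ j), ψ x⟫_ℝ) atTop (𝓝 0)) ∧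
        (∀ (j : Fin 3) (ψ : EuclideanSpace ℝ (Fin 3) → EuclideanSpace ℝ (Fin 3)), Continuous ψ → HasCompactSupport ψ →
          Tendsto (fun k => ∫ x, ⟪fderiv ℝ (Literature.Analysis.FluidPDE.curl (v (φ k) - w)) x
            (EuclideanSpace.basisFun (Fin 3) ℝ j), ψ x⟫_ℝ) atTop (𝓝 0)) ∧
        Tendsto (fun k => (∫ x, ⟪Literature.Analysis.FluidPDE.curl (v (φ k) - w) x, fderiv ℝ (v (φ k) - w) x (Literature.Analysis.FluidPDE.curl w x)⟫_ℝ) +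
          (∫ x, ⟪Literature.Analysis.FluidPDE.curl (v (φ k) - w) x, fderiv ℝ w x (Literature.Analysis.FluidPDE.curl (v (φ k) - w) x)⟫_ℝ) +
          (∫ x, ⟪Literature.Analysis.FluidPDE.curl w x, fderiv ℝ (v (φ k) - w) x (Literature.Analysis.FluidPDE.curl (v (φ k) - w) x)⟫_ℝ)) atTop (𝓝 0)) :
    Summit.NavierStokesRegularity.NavierStokesRegularity.Theses.EfficiencyFloor.NearSaturationNearMaximiser :=
  nearSaturationNearMaximiser_of_compact fun c hsharp =>
    compact_of_centredLocalTestFieldLimit hsharp.1 (fun f hf => hsharp.2.1 f hf) (HWt c hsharp)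

end SeqCore

end NearSaturationNearMaximiser

end Summit.NavierStokesRegularity.NavierStokesRegularity.Theorems

end
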